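import Mathlib
import Literature.AlgebraicGeometry.Resolution.CobordantGame
import Literature.AlgebraicGeometry.Resolution.CobordantArcLemma
import Literature.AlgebraicGeometry.Resolution.FormalCoordinateChange
import Literature.AlgebraicGeometry.Resolution.FormalInverseFunction
import Literature.RingTheory.MvPowerSeries.PartialDerivative
import Summits.ResolutionOfSingularities.ResolutionOfSingularities.Theorems.WeightedInvariantGlobalizeLocalDropCanonize
import Summits.ResolutionOfSingularities.ResolutionOfSingularities.Theorems.WeightedInvariantGlobalizeLocalDropCylinder
import Literature.AlgebraicGeometry.Resolution.PowerSeriesRegularLocal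
import Summits.ResolutionOfSingularities.ResolutionOfSingularities.Theorems.WeightedInvariantLocalWeightedDropConeDichotomyAux

/-!
# The rank-one formal Morse lemma with parameters: splitting off a square (char `≠ 2`)

Crux `LocalWeightedDrop` (stmt-ResolutionOfSingularities-8899, route
ResolutionOfSingularities/WeightedInvariant), line `hasse-ridge-face-selection`, registered stub
`stub_squareSplit` of the skeleton `LocalWeightedDrop`.  Over ANY field `k` with `2 ≠ 0`, a singular
germ `f ∈ k[[x₀, …, x_n]]` whose tangent quadric is the square `ℓ²` of a non-zero linear form `ℓ`
becomes `x₀² + H(x₁, …, x_n)` after a legal formal coordinate change `θ` (zero constant terms,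
invertible linear part); `H` is renamed into the slots `1, …, n` along `Fin.succEmb n : m ↦ m.succ`.

Proof.  Each step replaces `f` by `f ∘ φ` for a legal `φ`, which does not change the conclusion
(`SquareSplit.of_subst`: compose the coordinate changes, `linMat_comp`).
* LINEAR NORMALISATION (in the main proof).  With `ℓ_{i₀} ≠ 0` and `σ` the transposition `(0 i₀)`,
  `θ_l = x_{σ l} + [l = i₀] · ℓ_{i₀}⁻¹ (x₀ − ∑ ℓ_m x_{σ m})` satisfies `∑ ℓ_l θ_l = x₀`; it is legal
  because it has the explicit compositional inverse `(∑ ℓ_l x_l, x_{σ 1}, …)`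
  (`isUnit_det_linMat_of_comp_eq_X`).  As `f = ℓ(x)² + (order ≥ 3)`
  (`ConeDichotomy.three_le_order_sub_quadP`), `f ∘ θ = x₀² + (order ≥ 3)` — the NORMAL FORM
  `3 ≤ order (f − x₀²)` used from here on (`coeff_of_normal`).
* NO `x₀`-LINEAR TERMS (`exists_noLinear`).  `Ψ = (½ ∂₀ f, x₁, …, x_n)` has zero constant terms
  and linear part the identity matrix, hence a compositional inverse `ψ`
  (`FormalCoordChange.exists_comp_inverse`), again tangent to the identity
  (`CobordantArc.linMat_mul_of_comp_eq_X`), with `ψ_i = x_i` for `i ≥ 1`.  By the CHAIN RULE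
  (`pd_subst`) `∂₀ (f ∘ ψ) = (∂₀ f)(ψ) · ∂₀ ψ₀ = 2 x₀ · ∂₀ ψ₀` is divisible by `x₀`, so `g := f ∘ ψ`
  has no monomial of `x₀`-degree exactly `1`; and `coeff_{x₀²} g = coeff_{x₀²} f = 1` because
  tangent-to-identity substitutions do not change lowest-order coefficients
  (`FormalCoordChange.TangentId.coeff_subst_of_degree_le`).
* DECOMPOSITION (`decompose`).  `g = rename ι H + x₀² U` with `H := killCompl ι g` (the monomials
  without `x₀`, `ι = Fin.succEmb n`) and `U(0) = coeff_{x₀²} g = 1` (`X_pow_dvd_iff`).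
* HENSEL (`exists_sqrt`, `goal_of_noLinear`).  `k[[x]]` is complete for its maximal ideal
  (`maximalIdeal_mvPowerSeries_eq_span`), hence Henselian, and `T² − U` has the simple root `1`
  modulo `𝔪` (here `2 ≠ 0` is used): `U = u²` with `u(0) = 1`.  Then `g = G ∘ Ψ₂` for
  `G = x₀² + rename ι H` and `Ψ₂ = (x₀ u, x₁, …, x_n)`
  (linear part the identity), and the compositional inverse `θ₂` of `Ψ₂` gives `g ∘ θ₂ = G`
  (`subst_subst_of_comp_eq_X`).
-/

set_option linter.dupNamespace false -- mandated namespace of this single-conjunct summit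

namespace Summit.ResolutionOfSingularities.ResolutionOfSingularities.Theorems

open Literature.AlgebraicGeometry.Resolution

namespace SquareSplit

open MvPowerSeries Literature.RingTheory.MvPowerSeries

variable {k : Type} [Field k] {n : ℕ}

/-- REDUCTION STEP: the conclusion of the stub for `f ∘ φ` (`φ` legal) implies it for `f`
(compose the coordinate changes). -/
theorem of_subst {f : MvPowerSeries (Fin (n + 1)) k} {φ : Fin (n + 1) → MvPowerSeries (Fin (n + 1)) k}
    (hφ0 : ∀ i, constantCoeff (φ i) = 0) (hφdet : IsUnit (FormalCoordChange.linMat φ).det)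
    (h : ∃ θ : Fin (n + 1) → MvPowerSeries (Fin (n + 1)) k, (∀ i, constantCoeff (θ i) = 0) ∧
      IsUnit (Matrix.det (Matrix.of fun i j => coeff (Finsupp.single j 1) (θ i))) ∧
      ∃ H : MvPowerSeries (Fin n) k, subst θ (subst φ f) = X 0 ^ 2 + rename (Fin.succEmb n) H) :
    ∃ θ : Fin (n + 1) → MvPowerSeries (Fin (n + 1)) k, (∀ i, constantCoeff (θ i) = 0) ∧
      IsUnit (Matrix.det (Matrix.of fun i j => coeff (Finsupp.single j 1) (θ i))) ∧
      ∃ H : MvPowerSeries (Fin n) k, subst θ f = X 0 ^ 2 + rename (Fin.succEmb n) H := by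
  obtain ⟨θ, hθ0, hθdet, H, hH⟩ := h
  refine ⟨fun i => subst θ (φ i), constantCoeff_comp_eq_zero hφ0 hθ0, ?_, H, ?_⟩
  · change IsUnit (FormalCoordChange.linMat fun i => subst θ (φ i)).det
    rw [linMat_comp φ hθ0, Matrix.det_mul]
    exact hφdet.mul hθdet
  · rw [← subst_subst_eq_subst_comp hφ0 hθ0 f]
    exact hH

/-- Coefficients of degree `≤ 2` of a germ in the normal form `f = x₀² + (order ≥ 3)`. -/
theorem coeff_of_normal {f : MvPowerSeries (Fin (n + 1)) k} (hf : 3 ≤ (f - X 0 ^ 2).order)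
    {e : Fin (n + 1) →₀ ℕ} (he : e.degree ≤ 2) :
    coeff e f = if e = Finsupp.single 0 2 then 1 else 0 := by
  have h0 : coeff e (f - X 0 ^ 2) = 0 :=
    coeff_of_lt_order (lt_of_lt_of_le (by exact_mod_cast (by omega : e.degree < 3)) hf)
  rw [map_sub, sub_eq_zero] at h0
  rw [h0, coeff_X_pow]

/-! ### Killing the monomials of `x₀`-degree one: `Ψ = (½ ∂₀ f, x₁, …, x_n)` and its inverse -/

/-- NO `x₀`-LINEAR TERMS.  For `f = x₀² + (order ≥ 3)` and `2 ≠ 0`, the compositional inverse `ψ`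
of `Ψ = (½ ∂₀ f, x₁, …, x_n)` is legal, `f ∘ ψ` has no monomial of `x₀`-degree exactly `1`
(chain rule: `∂₀ (f ∘ ψ) = 2 x₀ · ∂₀ ψ₀`), and `coeff_{x₀²} (f ∘ ψ) = 1`. -/
theorem exists_noLinear (h2 : (2 : k) ≠ 0) {f : MvPowerSeries (Fin (n + 1)) k}
    (hf : 3 ≤ (f - X 0 ^ 2).order) :
    ∃ ψ : Fin (n + 1) → MvPowerSeries (Fin (n + 1)) k, (∀ i, constantCoeff (ψ i) = 0) ∧
      IsUnit (FormalCoordChange.linMat ψ).det ∧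
      (∀ d : Fin (n + 1) →₀ ℕ, d 0 = 1 → coeff d (subst ψ f) = 0) ∧
      coeff (Finsupp.single 0 2) (subst ψ f) = 1 := by
  have hcf := fun (e : Fin (n + 1) →₀ ℕ) (he : e.degree ≤ 2) => coeff_of_normal hf he
  obtain ⟨Ψ, hΨ⟩ : ∃ Ψ : Fin (n + 1) → MvPowerSeries (Fin (n + 1)) k,
      ∀ i, Ψ i = if i = 0 then (2⁻¹ : k) • pd 0 f else X i := ⟨_, fun _ => rfl⟩
  have hΨ0 : ∀ i, constantCoeff (Ψ i) = 0 := by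
    intro i
    rw [hΨ]
    split_ifs
    · rw [constantCoeff_smul, ← coeff_zero_eq_constantCoeff_apply, coeff_pd, zero_add,
        hcf _ (by simp), if_neg (by simp [Finsupp.single_eq_single_iff]), mul_zero, smul_zero]
    · exact constantCoeff_X _
  have hΨlin : FormalCoordChange.linMat Ψ = 1 := by
    ext i j
    rw [FormalCoordChange.linMat, Matrix.of_apply, Matrix.one_apply, hΨ]
    split_ifs with hi hij hij
    · subst hi; subst hij
      rw [map_smul, coeff_pd, ← Finsupp.single_add, hcf _ (by simp), if_pos rfl,
        Finsupp.single_eq_same, smul_eq_mul, mul_one]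
      norm_num
      exact inv_mul_cancel₀ h2
    · subst hi
      rw [map_smul, coeff_pd, hcf _ (by rw [map_add, Finsupp.degree_single, Finsupp.degree_single]),
        if_neg, mul_zero, smul_zero]
      intro h
      have := congrArg (· j) h
      simp only [Finsupp.add_apply, Finsupp.single_eq_same, Finsupp.single_apply, hij, if_false] at this
      omega
    · subst hij
      rw [coeff_index_single_self_X]
    · rw [coeff_index_single_X, if_neg (Ne.symm hij)]
  have hΨdet : IsUnit (FormalCoordChange.linMat Ψ).det := by
    rw [hΨlin, Matrix.det_one]
    exact isUnit_one
  obtain ⟨ψ, hψ0, hψΨ, -⟩ := FormalCoordChange.exists_comp_inverse hΨ0 hΨdet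
  have hψlin : FormalCoordChange.linMat ψ = 1 := by
    have h := CobordantArc.linMat_mul_of_comp_eq_X hψ0 hψΨ
    change FormalCoordChange.linMat Ψ * FormalCoordChange.linMat ψ = 1 at h
    rwa [hΨlin, one_mul] at h
  have hψs := hasSubst_of_constantCoeff_zero hψ0
  have hψX : ∀ m : Fin n, ψ m.succ = X m.succ := fun m => by
    have h := hψΨ m.succ
    rwa [hΨ, if_neg (Fin.succ_ne_zero m), subst_X hψs] at h
  -- the chain rule: `∂₀ (f ∘ ψ) = x₀ · (2 ∂₀ ψ₀)`
  have hpd : pd 0 (subst ψ f) = X 0 * ((2 : k) • pd 0 (ψ 0)) := by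
    rw [pd_subst ψ hψ0 f 0, Fin.sum_univ_succ]
    have hz : ∀ m : Fin n, pd (0 : Fin (n + 1)) (ψ m.succ) = 0 := fun m => by
      rw [hψX, pd_X, if_neg (Fin.succ_ne_zero m)]
    simp_rw [hz, mul_zero, Finset.sum_const_zero, add_zero]
    have hf2 : pd 0 f = (2 : k) • Ψ 0 := by
      rw [hΨ, if_pos rfl, smul_smul, mul_inv_cancel₀ h2, one_smul]
    rw [hf2, subst_smul hψs, hψΨ 0, smul_mul_assoc, ← mul_smul_comm]
  refine ⟨ψ, hψ0, by rw [hψlin, Matrix.det_one]; exact isUnit_one, fun d hd => ?_, ?_⟩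
  · have hd0 : d 0 ≠ 0 := by omega
    have he : (d - Finsupp.single 0 1 : Fin (n + 1) →₀ ℕ) 0 = 0 := by
      rw [Finsupp.tsub_apply, Finsupp.single_eq_same]; omega
    have h0 := (X_dvd_iff.mp ⟨_, hpd⟩) _ he
    rwa [coeff_pd, he, zero_add, Nat.cast_one, one_mul, Finsupp.sub_add_single_one_cancel hd0] at h0
  · have hT : FormalCoordChange.TangentId ψ := ⟨hψ0, fun i j => by
      have h := congrFun (congrFun hψlin i) j
      rwa [FormalCoordChange.linMat, Matrix.of_apply, Matrix.one_apply] at h⟩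
    have h2o : (2 : ℕ∞) ≤ f.order := nat_le_order fun d hd => by
      rw [hcf d hd.le, if_neg]
      rintro rfl
      simp at hd
    rw [hT.coeff_subst_of_degree_le f _ (by simpa using h2o), hcf _ (by simp), if_pos rfl]

/-! ### The decomposition `g = H(x₁, …, x_n) + x₀² U` and the square root of `U` -/

/-- The coefficients of `rename ι (killCompl ι g)` (`ι = Fin.succEmb n`): those of `g` on the
exponents not involving `x₀`, and `0` elsewhere. -/
theorem coeff_rename_killCompl_succ (g : MvPowerSeries (Fin (n + 1)) k) (d : Fin (n + 1) →₀ ℕ) :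
    coeff d (rename (Fin.succEmb n) (killCompl (Fin.succEmb n) g)) =
      if d 0 = 0 then coeff d g else 0 := by
  have hrange : (↑d.support : Set (Fin (n + 1))) ⊆ Set.range (Fin.succEmb n) ↔ d 0 = 0 := by
    rw [Fin.coe_succEmb, Fin.range_succ]
    constructor
    · intro h
      by_contra h0
      exact h (by simpa using h0) rfl
    · intro h i hi h0
      rw [Set.mem_singleton_iff] at h0
      rw [Finset.mem_coe, Finsupp.mem_support_iff, h0] at hi
      exact hi h
  split_ifs with h
  · obtain ⟨x, rfl⟩ := (Finsupp.mem_range_embDomain_iff _ d).mpr (hrange.mpr h)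
    rw [coeff_embDomain_rename, coeff_killCompl]
  · apply coeff_rename_eq_zero
    rintro ⟨x, rfl⟩
    apply h
    rw [← hrange, ← Finsupp.embDomain_eq_mapDomain]
    exact (Finsupp.mem_range_embDomain_iff _ _).mp ⟨x, rfl⟩

/-- DECOMPOSITION: a series without monomials of `x₀`-degree exactly `1` is
`rename ι (killCompl ι g) + x₀² U` with `U(0) = coeff_{x₀²} g`. -/
theorem decompose {g : MvPowerSeries (Fin (n + 1)) k}
    (hg1 : ∀ d : Fin (n + 1) →₀ ℕ, d 0 = 1 → coeff d g = 0) :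
    ∃ U : MvPowerSeries (Fin (n + 1)) k,
      g = rename (Fin.succEmb n) (killCompl (Fin.succEmb n) g) + X 0 ^ 2 * U ∧
      constantCoeff U = coeff (Finsupp.single 0 2) g := by
  set r := g - rename (Fin.succEmb n) (killCompl (Fin.succEmb n) g) with hr
  have hcoeff : ∀ d, coeff d r = if d 0 = 0 then 0 else coeff d g := fun d => by
    rw [hr, map_sub, coeff_rename_killCompl_succ]
    split_ifs <;> simp
  have hdvd : (X 0 : MvPowerSeries (Fin (n + 1)) k) ^ 2 ∣ r := by
    rw [X_pow_dvd_iff]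
    intro m hm
    rw [hcoeff]
    split_ifs with h0
    · rfl
    · exact hg1 m (by omega)
  obtain ⟨U, hU⟩ := hdvd
  refine ⟨U, by rw [← hU, hr, add_sub_cancel], ?_⟩
  have h1 : coeff (Finsupp.single 0 2) r = constantCoeff U := by
    rw [hU, X_pow_eq, coeff_monomial_mul, if_pos le_rfl, tsub_self, one_mul,
      coeff_zero_eq_constantCoeff_apply]
  rw [← h1, hcoeff, if_neg (by simp)]

/-- HENSEL SQUARE ROOT: a series `U ∈ k[[x₁, …, x_m]]` with `U(0) = 1` is a square `u²` with
`u(0) = 1` when `2 ≠ 0` in `k` (`k[[x]]` is `𝔪`-adically complete, hence Henselian, and `T² − U`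
has the simple root `1` modulo `𝔪`). -/
theorem exists_sqrt (h2 : (2 : k) ≠ 0) {m : ℕ} {U : MvPowerSeries (Fin m) k} (hU : constantCoeff U = 1) :
    ∃ u : MvPowerSeries (Fin m) k, u ^ 2 = U ∧ constantCoeff u = 1 := by
  haveI : IsAdicComplete (IsLocalRing.maximalIdeal (MvPowerSeries (Fin m) k)) (MvPowerSeries (Fin m) k) := by
    rw [maximalIdeal_mvPowerSeries_eq_span k (Fin m)]
    infer_instance
  have hmem : ∀ φ : MvPowerSeries (Fin m) k,
      φ ∈ IsLocalRing.maximalIdeal (MvPowerSeries (Fin m) k) ↔ constantCoeff φ = 0 := fun φ => by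
    rw [IsLocalRing.mem_maximalIdeal, mem_nonunits_iff, isUnit_iff_constantCoeff, isUnit_iff_ne_zero, not_not]
  set F : Polynomial (MvPowerSeries (Fin m) k) := Polynomial.X ^ 2 - Polynomial.C U with hF
  have heval : ∀ a, F.eval a = a ^ 2 - U := fun a => by simp [hF]
  have hder : F.derivative.eval 1 = 2 := by
    norm_num [hF]
  have h1 : F.eval 1 ∈ IsLocalRing.maximalIdeal _ := by
    rw [hmem, heval, map_sub, map_pow, map_one, hU, one_pow, sub_self]
  have h1' : IsUnit (Ideal.Quotient.mk (IsLocalRing.maximalIdeal _) (F.derivative.eval 1)) := by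
    rw [hder]
    refine IsUnit.map _ ?_
    rw [isUnit_iff_constantCoeff, map_ofNat, isUnit_iff_ne_zero]
    exact h2
  obtain ⟨u, hroot, hu⟩ := HenselianRing.is_henselian (I := IsLocalRing.maximalIdeal _) F
    (Polynomial.monic_X_pow_sub_C U two_ne_zero) 1 h1 h1'
  refine ⟨u, ?_, ?_⟩
  · rw [Polynomial.IsRoot.def, heval, sub_eq_zero] at hroot
    exact hroot
  · rw [hmem, map_sub, map_one, sub_eq_zero] at hu
    exact hu

/-- SQUARE ROOT AND INVERSION: a series `g` without monomials of `x₀`-degree exactly `1` and with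
`coeff_{x₀²} g = 1` becomes `x₀² + H(x₁, …, x_n)` after a legal coordinate change (`2 ≠ 0`):
`g = rename ι H + x₀² u²` by Hensel's lemma, i.e. `g = (x₀² + rename ι H) ∘ (x₀ u, x₁, …, x_n)`,
and the latter substitution is inverted by the formal inverse function theorem. -/
theorem goal_of_noLinear (h2 : (2 : k) ≠ 0) {g : MvPowerSeries (Fin (n + 1)) k}
    (hg1 : ∀ d : Fin (n + 1) →₀ ℕ, d 0 = 1 → coeff d g = 0)
    (hg2 : coeff (Finsupp.single 0 2) g = 1) :
    ∃ θ : Fin (n + 1) → MvPowerSeries (Fin (n + 1)) k, (∀ i, constantCoeff (θ i) = 0) ∧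
      IsUnit (Matrix.det (Matrix.of fun i j => coeff (Finsupp.single j 1) (θ i))) ∧
      ∃ H : MvPowerSeries (Fin n) k, subst θ g = X 0 ^ 2 + rename (Fin.succEmb n) H := by
  set ι : Fin n ↪ Fin (n + 1) := Fin.succEmb n with hι
  have hιm : ∀ m, ι m = m.succ := fun m => rfl
  set H : MvPowerSeries (Fin n) k := killCompl ι g with hH
  obtain ⟨U, hgU, hU0⟩ := decompose hg1
  rw [hg2] at hU0
  -- Hensel: `U = u²`, `u(0) = 1`
  obtain ⟨u, hu2, hu0⟩ := exists_sqrt h2 hU0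
  -- `Ψ = (x₀ u, x₁, …, x_n)`
  obtain ⟨Ψ, hΨ⟩ : ∃ Ψ : Fin (n + 1) → MvPowerSeries (Fin (n + 1)) k,
      ∀ i, Ψ i = if i = 0 then X 0 * u else X i := ⟨_, fun _ => rfl⟩
  have hΨ0 : ∀ i, constantCoeff (Ψ i) = 0 := fun i => by
    rw [hΨ]
    split_ifs <;> simp [constantCoeff_X]
  have hΨdet : IsUnit (FormalCoordChange.linMat Ψ).det := by
    have hlin : FormalCoordChange.linMat Ψ = 1 := by
      ext i j
      rw [FormalCoordChange.linMat, Matrix.of_apply, Matrix.one_apply, hΨ]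
      split_ifs with hi hij hij
      · subst hi; subst hij
        rw [X_def, coeff_monomial_mul, if_pos le_rfl, tsub_self, one_mul, coeff_zero_eq_constantCoeff_apply, hu0]
      · subst hi
        rw [X_def, coeff_monomial_mul, if_neg]
        rw [Finsupp.single_le_iff, Finsupp.single_eq_of_ne hij]
        exact Nat.not_succ_le_zero 0
      · subst hij
        rw [coeff_index_single_self_X]
      · rw [coeff_index_single_X, if_neg (Ne.symm hij)]
    rw [hlin, Matrix.det_one]
    exact isUnit_one
  have hΨs := hasSubst_of_constantCoeff_zero hΨ0
  have hgΨ : subst Ψ (X 0 ^ 2 + rename ι H) = g := by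
    rw [subst_add hΨs, subst_pow hΨs, subst_X hΨs, subst_rename_eq ι Ψ hΨ0 H]
    have hren : (fun m => Ψ (ι m)) = X ∘ ι := funext fun m => by
      rw [Function.comp_apply, hΨ, hιm, if_neg (Fin.succ_ne_zero m)]
    rw [hren, ← rename_eq_subst, hΨ, if_pos rfl, mul_pow, hu2, hgU]
    ring
  obtain ⟨θ, hθ0, hθΨ, -⟩ := FormalCoordChange.exists_comp_inverse hΨ0 hΨdet
  refine ⟨θ, hθ0, isUnit_det_linMat_of_comp_eq_X hθ0 hθΨ, H, ?_⟩
  rw [← hgΨ]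
  exact subst_subst_of_comp_eq_X hΨ0 hθ0 hθΨ _

end SquareSplit

open SquareSplit MvPowerSeries in
/-- Stub `stub_squareSplit` of the skeleton `LocalWeightedDrop` (line `hasse-ridge-face-selection`):
SQUARE SPLITTING, the rank-one formal Morse lemma with parameters over any field with `2 ≠ 0`.  If
the tangent quadric of a singular germ `f ∈ k[[x₀, …, x_n]]` is the square `ℓ²` of a non-zero linear
form, then `f ∘ θ = x₀² + H(x₁, …, x_n)` for a legal formal coordinate change `θ` — linear
normalisation of `ℓ` to `x₀`, removal of the `x₀`-linear monomials through the inverse of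
`(½ ∂₀ f, x₁, …, x_n)`, decomposition `H + x₀² U`, Hensel square root of `U`, inversion of
`(x₀ u, x₁, …, x_n)`. -/
theorem stub_squareSplit : ∀ (k : Type) [Field k], (2 : k) ≠ 0 → ∀ (n : ℕ) (f : MvPowerSeries (Fin (n + 1)) k),
    CobordantGame.IsSingular k f →
    (∃ ℓ : Fin (n + 1) → k, (∃ i, ℓ i ≠ 0) ∧ ∀ i j : Fin (n + 1),
      MvPowerSeries.coeff (Finsupp.single i 1 + Finsupp.single j 1) f =
        MvPowerSeries.coeff (Finsupp.single i 1 + Finsupp.single j 1)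
          ((∑ l, MvPowerSeries.C (ℓ l) * MvPowerSeries.X l) ^ 2)) →
    ∃ θ : Fin (n + 1) → MvPowerSeries (Fin (n + 1)) k, (∀ i, MvPowerSeries.constantCoeff (θ i) = 0) ∧
      IsUnit (Matrix.det (Matrix.of fun i j => MvPowerSeries.coeff (Finsupp.single j 1) (θ i))) ∧
      ∃ H : MvPowerSeries (Fin n) k, MvPowerSeries.subst θ f =
        MvPowerSeries.X (0 : Fin (n + 1)) ^ 2 + MvPowerSeries.rename (Fin.succEmb n) H := by
  intro k _ h2 n f hf hq
  obtain ⟨ℓ, ⟨i₀, hi₀⟩, hq⟩ := hq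
  obtain ⟨-, hf0, hf1⟩ := hf
  -- LINEAR NORMALISATION: `θ_l = x_{σ l} + [l = i₀] ℓ_{i₀}⁻¹ (x₀ - ∑ ℓ_m x_{σ m})`, `σ = (0 i₀)`
  set σ : Equiv.Perm (Fin (n + 1)) := Equiv.swap 0 i₀ with hσ
  obtain ⟨θ, hθ⟩ : ∃ θ : Fin (n + 1) → MvPowerSeries (Fin (n + 1)) k, ∀ l, θ l =
      X (σ l) + if l = i₀ then (ℓ i₀)⁻¹ • (X 0 - ∑ m, ℓ m • X (σ m)) else 0 := ⟨_, fun _ => rfl⟩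
  have hθ0 : ∀ l, constantCoeff (θ l) = 0 := fun l => by
    rw [hθ]
    split_ifs <;> simp [constantCoeff_X, constantCoeff_smul, map_sum]
  have hθs := hasSubst_of_constantCoeff_zero hθ0
  have hsum : ∑ l, ℓ l • θ l = X 0 := by
    simp_rw [hθ, smul_add, Finset.sum_add_distrib, smul_ite, smul_zero, Finset.sum_ite_eq', Finset.mem_univ,
      if_true, smul_smul, mul_inv_cancel₀ hi₀, one_smul]
    abel
  -- legality through the explicit compositional inverse `(∑ ℓ_l x_l, x_{σ 1}, …, x_{σ n})`
  obtain ⟨φ, hφ⟩ : ∃ φ : Fin (n + 1) → MvPowerSeries (Fin (n + 1)) k,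
      ∀ s, φ s = if s = 0 then ∑ l, ℓ l • X l else X (σ s) := ⟨_, fun _ => rfl⟩
  have hcomp : ∀ s, subst θ (φ s) = X s := fun s => by
    rw [hφ]
    split_ifs with hs
    · subst hs
      rw [← coe_substAlgHom hθs, map_sum]
      simp_rw [map_smul, substAlgHom_X hθs]
      exact hsum
    · have hσs : σ s ≠ i₀ := fun h => hs (σ.injective (h.trans (Equiv.swap_apply_left 0 i₀).symm))
      rw [subst_X hθs, hθ, if_neg hσs, add_zero, hσ, Equiv.swap_apply_self]
  have hθdet : IsUnit (FormalCoordChange.linMat θ).det := isUnit_det_linMat_of_comp_eq_X hθ0 hcomp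
  -- the normal form `f ∘ θ = x₀² + (order ≥ 3)`
  set c : Matrix (Fin (n + 1)) (Fin (n + 1)) k := Matrix.of fun a b => ℓ a * ℓ b with hc
  have hQ : (∑ l, C (ℓ l) * X l : MvPowerSeries (Fin (n + 1)) k) ^ 2 = ∑ a, ∑ b, c a b • (X a * X b) :=
    ConeDichotomy.sq_linear_eq_quadP ℓ
  have hR : 3 ≤ (f - ∑ a, ∑ b, c a b • (X a * X b)).order :=
    ConeDichotomy.three_le_order_sub_quadP f c hf0 hf1 fun i j => by
      rw [hq, hQ, ConeDichotomy.coeff_pair_quadP]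
  have hsubQ : subst θ (∑ a, ∑ b, c a b • (X a * X b : MvPowerSeries (Fin (n + 1)) k)) = X 0 ^ 2 := by
    rw [← hQ, subst_pow hθs, ← coe_substAlgHom hθs, map_sum]
    simp_rw [← smul_eq_C_mul, map_smul, substAlgHom_X hθs, hsum]
  have hnormal : 3 ≤ (subst θ f - X 0 ^ 2).order := by
    rw [show subst θ f - X 0 ^ 2 = subst θ (f - ∑ a, ∑ b, c a b • (X a * X b)) by
      rw [subst_sub hθs, hsubQ]]
    exact ConeDichotomy.le_order_subst_of_le θ hθ0 _ 3 hR
  -- assemble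
  refine of_subst hθ0 hθdet ?_
  obtain ⟨ψ, hψ0, hψdet, hg1, hg2⟩ := exists_noLinear h2 hnormal
  exact of_subst hψ0 hψdet (goal_of_noLinear h2 hg1 hg2)

end Summit.ResolutionOfSingularities.ResolutionOfSingularities.Theorems
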